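import Summits.CriticalPhenomena.PercolationContinuityZ3.Theorems.PercNearOneGluingNoHeavyLowerTailIncStarWDOMAllOrNothingCore
import Summits.CriticalPhenomena.PercolationContinuityZ3.Theorems.PercNearOneGluingNoHeavyLowerTailIncStarWDOMAllOrNothingEvents
import HarnessLib

/-!
# The all-or-nothing root lemma, part 3: the theorem (Sahi programme, prover prim-sahi-p2 gen 36)

Support file (`--supports stmt-CriticalPhenomena-4575`); no definitions, no named facts, no sorries; standard axioms.  Memo
`run/shared/lean/prim/prim-sahi/FROM-prim-sahi-p2-gen36-ALL-OR-NOTHING.md` §2, `prim-sahi-p2/PROOF-E3.md` §46.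

**`allOrNothing_root`.**  Let `s, i, j` be distinct, `F` a set of pairs containing `s` with `s(s,i), s(s,j) ∉ F`, `w⁰` a weight with
`w⁰ s(s,v) = 0` for every `v ∉ {s, i, j}` (a two-pronged root; the rest of the graph ARBITRARY) and `w¹ = w⁰[F ↦ 1]` (the root merged with
all its `F`-neighbours).  Then, with `q^ε_v = P_{w^ε}(s ↔ v)`, `q^ε_{ij} = P_{w^ε}(s ↔ i, s ↔ j)`:
`q¹_i (q¹_j − q⁰_j) + q¹_j (q¹_i − q⁰_i) ≤ 2 (q¹_{ij} − q⁰_{ij})`.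
In words: opening ALL the other root pairs at once raises the double connection by at least the `W`-weighted single connections
(constants of the opened graph) — whereas opening ONE root pair may fail to (memo §1: the PIV corner, and the exact BETA-DOM refutation).
Proof: two-pair pinning of the gates (`real_twoBondDecomp`), push-forward `P_{w¹} = P_{w⁰} ∘ (· ∪ F)⁻¹` (`real_map_union`), the last-exit
description of `{s ↔ i}` under the four pinned laws (`mem_openConn_rootPairs`, `union_mem_openConn_rootPairs`), the insert-couplings to move every
`H`-event to the law `P⁰⁰`, Harris for `(I, J ∪ U)` and `(J, I ∪ U)`, inclusion–exclusion, and the polynomial core `allOrNothing_core`.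
-/

noncomputable section

namespace Summit.CriticalPhenomena.PercolationContinuityZ3.Theorems

namespace IncStar

open MeasureTheory Set Literature.Probability.Percolation Literature.Probability.LatticeModels EdgeInduction
open scoped Classical

variable {n : ℕ}

set_option maxHeartbeats 800000 in
/-- **ALL-OR-NOTHING ROOT LEMMA.**  `s, i, j` distinct; `F` a set of pairs containing `s`, `s(s,i), s(s,j) ∉ F`; `w⁰ s(s,v) = 0` for all
`v ∉ {s,i,j}`; `w¹ = w⁰[F ↦ 1]`.  Then `q¹_i (q¹_j − q⁰_j) + q¹_j (q¹_i − q⁰_i) ≤ 2 (q¹_{ij} − q⁰_{ij})` (notation in the module docstring).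
[this work] -/
theorem allOrNothing_root (w0 w1 : Sym2 (Fin n) → unitInterval) {s i j : Fin n} (his : i ≠ s) (hjs : j ≠ s) (hij : i ≠ j)
    (F : Set (Sym2 (Fin n))) (hF : ∀ e ∈ F, s ∈ e) (hFi : s(s, i) ∉ F) (hFj : s(s, j) ∉ F)
    (hroot : ∀ v : Fin n, v ≠ s → v ≠ i → v ≠ j → w0 s(s, v) = 0)
    (hw1 : w1 = fun e => if e ∈ F then 1 else w0 e) :
    (prodBernoulli w1).real (openConn s i) * ((prodBernoulli w1).real (openConn s j) - (prodBernoulli w0).real (openConn s j))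
      + (prodBernoulli w1).real (openConn s j) * ((prodBernoulli w1).real (openConn s i) - (prodBernoulli w0).real (openConn s i))
      ≤ 2 * ((prodBernoulli w1).real (openConn s i ∩ openConn s j) - (prodBernoulli w0).real (openConn s i ∩ openConn s j)) := by
  set e₁ : Sym2 (Fin n) := s(s, i) with he₁
  set e₂ : Sym2 (Fin n) := s(s, j) with he₂
  have hne : e₁ ≠ e₂ := by
    rw [he₁, he₂]; intro h; rw [Sym2.eq_iff] at h
    rcases h with ⟨_, h⟩ | ⟨_, h⟩; exacts [hij h, his h]
  set Bi : Set (BondConfig (Fin n)) := openConn s i with hBi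
  set Bj : Set (BondConfig (Fin n)) := openConn s j with hBj
  -- gates
  set a : ℝ := (w0 e₁ : ℝ) with ha
  set b : ℝ := (w0 e₂ : ℝ) with hb
  have ha0 : 0 ≤ a := (w0 e₁).2.1; have ha1 : a ≤ 1 := (w0 e₁).2.2
  have hb0 : 0 ≤ b := (w0 e₂).2.1; have hb1 : b ≤ 1 := (w0 e₂).2.2
  have hw1e₁ : (w1 e₁ : ℝ) = a := by rw [hw1]; simp only [if_neg hFi, ← ha]
  have hw1e₂ : (w1 e₂ : ℝ) = b := by rw [hw1]; simp only [if_neg hFj, ← hb]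
  -- pinned laws of `w0`
  set Q00 := pin₂ w0 e₁ e₂ 0 0 with hQ00
  set Q01 := pin₂ w0 e₁ e₂ 0 1 with hQ01
  set Q10 := pin₂ w0 e₁ e₂ 1 0 with hQ10
  set Q11 := pin₂ w0 e₁ e₂ 1 1 with hQ11
  haveI : IsProbabilityMeasure Q00 := by rw [hQ00]; unfold pin₂; infer_instance
  haveI : IsProbabilityMeasure Q01 := by rw [hQ01]; unfold pin₂; infer_instance
  haveI : IsProbabilityMeasure Q10 := by rw [hQ10]; unfold pin₂; infer_instance
  haveI : IsProbabilityMeasure Q11 := by rw [hQ11]; unfold pin₂; infer_instance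
  -- the pinned laws of `w1` are the `F`-opened pinned laws of `w0`
  have hpinF : ∀ x y : unitInterval, Function.update (Function.update w1 e₁ x) e₂ y =
      fun e => if e ∈ F then 1 else Function.update (Function.update w0 e₁ x) e₂ y e := by
    intro x y; funext e
    rw [pin₂_update_apply w1 hne, pin₂_update_apply w0 hne]
    by_cases h2 : e = e₂
    · subst h2; simp only [if_true, if_neg hFj]
    by_cases h1 : e = e₁
    · subst h1; simp only [if_neg h2, if_true, if_neg hFi]
    · simp only [if_neg h2, if_neg h1, hw1]
  have cplF : ∀ (x y : unitInterval) (X : Set (BondConfig (Fin n))),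
      (pin₂ w1 e₁ e₂ x y).real X = (pin₂ w0 e₁ e₂ x y).real ((fun ω : BondConfig (Fin n) => ω ∪ F) ⁻¹' X) := by
    intro x y X
    rw [pin₂, pin₂, hpinF x y]
    exact real_map_union _ F X
  -- insert-couplings to `Q00`
  have cpl01 : ∀ X : Set (BondConfig (Fin n)), Q01.real X = Q00.real ((fun ω : BondConfig (Fin n) => insert e₂ ω) ⁻¹' X) :=
    fun X => by rw [hQ01, hQ00]; exact pin₂_real_zero_one_eq_zero_zero w0 e₁ e₂ X
  have cpl10 : ∀ X : Set (BondConfig (Fin n)), Q10.real X = Q00.real ((fun ω : BondConfig (Fin n) => insert e₁ ω) ⁻¹' X) :=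
    fun X => by rw [hQ10, hQ00]; exact pin₂_real_one_zero_eq_zero_zero w0 hne X
  -- the `H`-events (away from the root)
  set U : Set (BondConfig (Fin n)) := {ω | (openGraph (ω \ {f : Sym2 (Fin n) | s ∈ f})).Reachable i j} with hU
  set I : Set (BondConfig (Fin n)) :=
    {ω | ∃ u : Fin n, u ≠ s ∧ s(s, u) ∈ F ∧ (openGraph (ω \ {f : Sym2 (Fin n) | s ∈ f})).Reachable u i} with hI
  set J : Set (BondConfig (Fin n)) :=
    {ω | ∃ u : Fin n, u ≠ s ∧ s(s, u) ∈ F ∧ (openGraph (ω \ {f : Sym2 (Fin n) | s ∈ f})).Reachable u j} with hJ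
  have hs₁ : s ∈ e₁ := by rw [he₁]; exact Sym2.mem_mk_left _ _
  have hs₂ : s ∈ e₂ := by rw [he₂]; exact Sym2.mem_mk_left _ _
  have insU : ∀ {e : Sym2 (Fin n)}, s ∈ e → ∀ ω : BondConfig (Fin n), insert e ω ∈ U ↔ ω ∈ U := by
    intro e he ω; simp only [hU, Set.mem_setOf_eq]; rw [sdiff_rootPairs_insert he]
  have insI : ∀ {e : Sym2 (Fin n)}, s ∈ e → ∀ ω : BondConfig (Fin n), insert e ω ∈ I ↔ ω ∈ I := by
    intro e he ω; simp only [hI, Set.mem_setOf_eq]; rw [sdiff_rootPairs_insert he]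
  have insJ : ∀ {e : Sym2 (Fin n)}, s ∈ e → ∀ ω : BondConfig (Fin n), insert e ω ∈ J ↔ ω ∈ J := by
    intro e he ω; simp only [hJ, Set.mem_setOf_eq]; rw [sdiff_rootPairs_insert he]
  have symU : ∀ ω : BondConfig (Fin n), (openGraph (ω \ {f : Sym2 (Fin n) | s ∈ f})).Reachable j i ↔ ω ∈ U :=
    fun ω => ⟨fun h => h.symm, fun h => SimpleGraph.Reachable.symm h⟩
  -- set algebra of `I, J, U`: `I ∩ U ⊆ J`, `J ∩ U ⊆ I`
  have hIUJ : ∀ ω, ω ∈ I → ω ∈ U → ω ∈ J := by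
    rintro ω ⟨u, hus, hsu, hr⟩ hU'
    exact ⟨u, hus, hsu, hr.trans hU'⟩
  have hJUI : ∀ ω, ω ∈ J → ω ∈ U → ω ∈ I := by
    rintro ω ⟨u, hus, hsu, hr⟩ hU'
    exact ⟨u, hus, hsu, hr.trans (SimpleGraph.Reachable.symm hU')⟩
  have setJU : J ∩ U = I ∩ U := by
    ext ω; simp only [Set.mem_inter_iff]
    exact ⟨fun h => ⟨hJUI ω h.1 h.2, h.2⟩, fun h => ⟨hIUJ ω h.1 h.2, h.2⟩⟩
  have setI_JU : I ∩ (J ∪ U) = I ∩ J := by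
    ext ω; simp only [Set.mem_inter_iff, Set.mem_union]
    constructor
    · rintro ⟨h1, h2 | h2⟩; exacts [⟨h1, h2⟩, ⟨h1, hIUJ ω h1 h2⟩]
    · rintro ⟨h1, h2⟩; exact ⟨h1, Or.inl h2⟩
  have setJ_IU : J ∩ (I ∪ U) = I ∩ J := by
    ext ω; simp only [Set.mem_inter_iff, Set.mem_union]
    constructor
    · rintro ⟨h1, h2 | h2⟩; exacts [⟨h2, h1⟩, ⟨hJUI ω h1 h2, h1⟩]
    · rintro ⟨h1, h2⟩; exact ⟨h2, Or.inl h1⟩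
  have setIJ_U : (I ∪ J) ∩ U = I ∩ U := by
    ext ω; simp only [Set.mem_inter_iff, Set.mem_union]
    constructor
    · rintro ⟨h1 | h1, h2⟩; exacts [⟨h1, h2⟩, ⟨hJUI ω h1 h2, h2⟩]
    · rintro ⟨h1, h2⟩; exact ⟨Or.inl h1, h2⟩
  have subIU_IJ : I ∩ U ⊆ I ∩ J := fun ω h => ⟨h.1, hIUJ ω h.1 h.2⟩
  -- upper sets
  have upU : IsUpperSet U := fun ω ω' hle hω => reach_offRoot_mono hle hω
  have upI : IsUpperSet I := by
    rintro ω ω' hle ⟨u, hus, hsu, hr⟩; exact ⟨u, hus, hsu, reach_offRoot_mono hle hr⟩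
  have upJ : IsUpperSet J := by
    rintro ω ω' hle ⟨u, hus, hsu, hr⟩; exact ⟨u, hus, hsu, reach_offRoot_mono hle hr⟩
  have upJU : IsUpperSet (J ∪ U) := upJ.union upU
  have upIU : IsUpperSet (I ∪ U) := upI.union upU
  have hm : ∀ Z : Set (BondConfig (Fin n)), MeasurableSet Z := fun _ => MeasurableSet.of_discrete
  -- the seven numbers
  set PI := Q00.real I with hPI; set PJ := Q00.real J with hPJ; set PIJ := Q00.real (I ∩ J) with hPIJ
  set u := Q00.real U with hu; set PIU := Q00.real (I ∪ U) with hPIU; set PJU := Q00.real (J ∪ U) with hPJU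
  set t := Q00.real (I ∩ U) with ht
  have hIUe : PIU + t = PI + u := by rw [hPIU, ht, hPI, hu]; exact measureReal_union_add_inter (hm U)
  have hJUe : PJU + t = PJ + u := by
    rw [hPJU, ht, hPJ, hu, ← setJU]; exact measureReal_union_add_inter (hm U)
  have hHarI : PI * PJU ≤ PIJ := by
    rw [hPI, hPJU, hPIJ, ← setI_JU]; exact prodBernoulli_harris _ upI upJU (hm _) (hm _)
  have hHarJ : PJ * PIU ≤ PIJ := by
    rw [hPJ, hPIU, hPIJ, ← setJ_IU]; exact prodBernoulli_harris _ upJ upIU (hm _) (hm _)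
  have hPIJ_le_PI : PIJ ≤ PI := measureReal_mono Set.inter_subset_left; have hPIJ_le_PJ : PIJ ≤ PJ := measureReal_mono Set.inter_subset_right
  have ht_le_PIJ : t ≤ PIJ := measureReal_mono subIU_IJ; have ht_le_u : t ≤ u := measureReal_mono Set.inter_subset_right
  have ht0 : 0 ≤ t := measureReal_nonneg
  have hunion : PI + PJ - PIJ + u - t ≤ 1 := by
    have h1 : Q00.real (I ∪ J) + PIJ = PI + PJ := by rw [hPIJ, hPI, hPJ]; exact measureReal_union_add_inter (hm J)
    have h2 : Q00.real (I ∪ J ∪ U) + t = Q00.real (I ∪ J) + u := by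
      rw [ht, hu, ← setIJ_U]; exact measureReal_union_add_inter (hm U)
    have h3 : Q00.real (I ∪ J ∪ U) ≤ 1 := measureReal_le_one
    linarith
  -- sure sets of the four pinned laws of `w0`
  have wval := pin₂_update_apply w0 hne
  have other_ne : ∀ v : Fin n, v ≠ i → v ≠ j → s(s, v) ≠ e₁ ∧ s(s, v) ≠ e₂ := fun v hvi hvj => rootPair_ne_of_ne hvi hvj
  have sure : ∀ (x y : unitInterval), (pin₂ w0 e₁ e₂ x y).real
      ({ω | ∀ f, Function.update (Function.update w0 e₁ x) e₂ y f = 1 → f ∈ ω} ∩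
        {ω | ∀ f, Function.update (Function.update w0 e₁ x) e₂ y f = 0 → f ∉ ω}) = 1 := fun x y => real_sureSet _
  have rootfree : ∀ (x y : unitInterval) (ω : BondConfig (Fin n)),
      ω ∈ ({ω | ∀ f, Function.update (Function.update w0 e₁ x) e₂ y f = 1 → f ∈ ω} ∩
        {ω | ∀ f, Function.update (Function.update w0 e₁ x) e₂ y f = 0 → f ∉ ω} : Set (BondConfig (Fin n))) →
      ∀ v : Fin n, v ≠ s → v ≠ i → v ≠ j → s(s, v) ∉ ω := by
    intro x y ω hω v hvs hvi hvj
    apply hω.2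
    rw [wval, if_neg (other_ne v hvi hvj).2, if_neg (other_ne v hvi hvj).1]
    exact hroot v hvs hvi hvj
  have mem₂_one : ∀ (x : unitInterval) (ω : BondConfig (Fin n)),
      ω ∈ ({ω | ∀ f, Function.update (Function.update w0 e₁ x) e₂ 1 f = 1 → f ∈ ω} ∩
        {ω | ∀ f, Function.update (Function.update w0 e₁ x) e₂ 1 f = 0 → f ∉ ω} : Set (BondConfig (Fin n))) → e₂ ∈ ω :=
    fun x ω hω => hω.1 e₂ (by rw [wval, if_pos rfl])
  have nmem₂_zero : ∀ (x : unitInterval) (ω : BondConfig (Fin n)),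
      ω ∈ ({ω | ∀ f, Function.update (Function.update w0 e₁ x) e₂ 0 f = 1 → f ∈ ω} ∩
        {ω | ∀ f, Function.update (Function.update w0 e₁ x) e₂ 0 f = 0 → f ∉ ω} : Set (BondConfig (Fin n))) → e₂ ∉ ω :=
    fun x ω hω => hω.2 e₂ (by rw [wval, if_pos rfl])
  have mem₁_one : ∀ (y : unitInterval) (ω : BondConfig (Fin n)),
      ω ∈ ({ω | ∀ f, Function.update (Function.update w0 e₁ 1) e₂ y f = 1 → f ∈ ω} ∩
        {ω | ∀ f, Function.update (Function.update w0 e₁ 1) e₂ y f = 0 → f ∉ ω} : Set (BondConfig (Fin n))) → e₁ ∈ ω :=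
    fun y ω hω => hω.1 e₁ (by rw [wval, if_neg hne, if_pos rfl])
  have nmem₁_zero : ∀ (y : unitInterval) (ω : BondConfig (Fin n)),
      ω ∈ ({ω | ∀ f, Function.update (Function.update w0 e₁ 0) e₂ y f = 1 → f ∈ ω} ∩
        {ω | ∀ f, Function.update (Function.update w0 e₁ 0) e₂ y f = 0 → f ∉ ω} : Set (BondConfig (Fin n))) → e₁ ∉ ω :=
    fun y ω hω => hω.2 e₁ (by rw [wval, if_neg hne, if_pos rfl])
  set G00 : Set (BondConfig (Fin n)) := {ω | ∀ f, Function.update (Function.update w0 e₁ 0) e₂ 0 f = 1 → f ∈ ω} ∩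
    {ω | ∀ f, Function.update (Function.update w0 e₁ 0) e₂ 0 f = 0 → f ∉ ω} with hG00
  set G01 : Set (BondConfig (Fin n)) := {ω | ∀ f, Function.update (Function.update w0 e₁ 0) e₂ 1 f = 1 → f ∈ ω} ∩
    {ω | ∀ f, Function.update (Function.update w0 e₁ 0) e₂ 1 f = 0 → f ∉ ω} with hG01
  set G10 : Set (BondConfig (Fin n)) := {ω | ∀ f, Function.update (Function.update w0 e₁ 1) e₂ 0 f = 1 → f ∈ ω} ∩
    {ω | ∀ f, Function.update (Function.update w0 e₁ 1) e₂ 0 f = 0 → f ∉ ω} with hG10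
  set G11 : Set (BondConfig (Fin n)) := {ω | ∀ f, Function.update (Function.update w0 e₁ 1) e₂ 1 f = 1 → f ∈ ω} ∩
    {ω | ∀ f, Function.update (Function.update w0 e₁ 1) e₂ 1 f = 0 → f ∉ ω} with hG11
  have s00 : Q00.real G00 = 1 := sure 0 0; have s01 : Q01.real G01 = 1 := sure 0 1
  have s10 : Q10.real G10 = 1 := sure 1 0; have s11 : Q11.real G11 = 1 := sure 1 1
  -- characterisations of `Bi`, `Bj` and of their `∪ F`-preimages on root-free configurations
  have chBi : ∀ ω : BondConfig (Fin n), (∀ v : Fin n, v ≠ s → v ≠ i → v ≠ j → s(s, v) ∉ ω) →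
      (ω ∈ Bi ↔ e₁ ∈ ω ∨ (e₂ ∈ ω ∧ ω ∈ U)) := by
    intro ω hω; rw [hBi, mem_openConn_rootPairs his hjs hω, symU ω]
  have chBj : ∀ ω : BondConfig (Fin n), (∀ v : Fin n, v ≠ s → v ≠ i → v ≠ j → s(s, v) ∉ ω) →
      (ω ∈ Bj ↔ e₂ ∈ ω ∨ (e₁ ∈ ω ∧ ω ∈ U)) := by
    intro ω hω
    have hω' : ∀ v : Fin n, v ≠ s → v ≠ j → v ≠ i → s(s, v) ∉ ω := fun v h1 h2 h3 => hω v h1 h3 h2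
    rw [hBj, mem_openConn_rootPairs hjs his hω']
    exact Iff.rfl
  have chFBi : ∀ ω : BondConfig (Fin n), (∀ v : Fin n, v ≠ s → v ≠ i → v ≠ j → s(s, v) ∉ ω) →
      ((ω ∪ F : BondConfig (Fin n)) ∈ Bi ↔ e₁ ∈ ω ∨ (e₂ ∈ ω ∧ ω ∈ U) ∨ ω ∈ I) := by
    intro ω hω; rw [hBi, union_mem_openConn_rootPairs his hjs hF hFi hω, symU ω]
    exact Iff.rfl
  have chFBj : ∀ ω : BondConfig (Fin n), (∀ v : Fin n, v ≠ s → v ≠ i → v ≠ j → s(s, v) ∉ ω) →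
      ((ω ∪ F : BondConfig (Fin n)) ∈ Bj ↔ e₂ ∈ ω ∨ (e₁ ∈ ω ∧ ω ∈ U) ∨ ω ∈ J) := by
    intro ω hω
    have hω' : ∀ v : Fin n, v ≠ s → v ≠ j → v ≠ i → s(s, v) ∉ ω := fun v h1 h2 h3 => hω v h1 h3 h2
    rw [hBj, union_mem_openConn_rootPairs hjs his hF hFj hω']
    exact Iff.rfl
  -- values under Q00 (ω-side: both gates closed)
  have zero00 : ∀ Z : Set (BondConfig (Fin n)), (∀ ω ∈ G00, ω ∉ Z) → Q00.real Z = 0 := by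
    intro Z hZ; have h0 : Q00.real (∅ : Set (BondConfig (Fin n))) = 0 := by simp
    rw [← h0]; refine real_congr_on_sure s00 fun ω hω => ?_; simp only [Set.mem_empty_iff_false, iff_false]; exact hZ ω hω
  have nB00 : ∀ ω ∈ G00, ω ∉ Bi ∧ ω ∉ Bj := by
    intro ω hω
    have h1 := nmem₁_zero 0 ω hω; have h2 := nmem₂_zero 0 ω hω
    rw [chBi ω (rootfree 0 0 ω hω), chBj ω (rootfree 0 0 ω hω)]
    exact ⟨fun h => h.elim h1 (fun h' => h2 h'.1), fun h => h.elim h2 (fun h' => h1 h'.1)⟩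
  have v00_i : Q00.real Bi = 0 := zero00 _ fun ω hω h => (nB00 ω hω).1 h
  have v00_j : Q00.real Bj = 0 := zero00 _ fun ω hω h => (nB00 ω hω).2 h
  have v00_ij : Q00.real (Bi ∩ Bj) = 0 := zero00 _ fun ω hω h => (nB00 ω hω).1 h.1
  -- values under Q00, `∪ F` side
  have f00_i : Q00.real ((fun ω : BondConfig (Fin n) => ω ∪ F) ⁻¹' Bi) = PI := by
    rw [hPI]; refine real_congr_on_sure s00 fun ω hω => ?_
    have h1 := nmem₁_zero 0 ω hω; have h2 := nmem₂_zero 0 ω hω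
    simp only [Set.mem_preimage]; rw [chFBi ω (rootfree 0 0 ω hω)]
    exact ⟨fun h => h.elim (fun h' => absurd h' h1) (fun h' => h'.elim (fun h'' => absurd h''.1 h2) id), fun h => Or.inr (Or.inr h)⟩
  have f00_j : Q00.real ((fun ω : BondConfig (Fin n) => ω ∪ F) ⁻¹' Bj) = PJ := by
    rw [hPJ]; refine real_congr_on_sure s00 fun ω hω => ?_
    have h1 := nmem₁_zero 0 ω hω; have h2 := nmem₂_zero 0 ω hω
    simp only [Set.mem_preimage]; rw [chFBj ω (rootfree 0 0 ω hω)]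
    exact ⟨fun h => h.elim (fun h' => absurd h' h2) (fun h' => h'.elim (fun h'' => absurd h''.1 h1) id), fun h => Or.inr (Or.inr h)⟩
  have f00_ij : Q00.real ((fun ω : BondConfig (Fin n) => ω ∪ F) ⁻¹' (Bi ∩ Bj)) = PIJ := by
    rw [hPIJ]; refine real_congr_on_sure s00 fun ω hω => ?_
    have h1 := nmem₁_zero 0 ω hω; have h2 := nmem₂_zero 0 ω hω
    simp only [Set.mem_preimage, Set.mem_inter_iff]; rw [chFBi ω (rootfree 0 0 ω hω), chFBj ω (rootfree 0 0 ω hω)]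
    constructor
    · rintro ⟨hi, hj⟩
      refine ⟨hi.elim (fun h' => absurd h' h1) (fun h' => h'.elim (fun h'' => absurd h''.1 h2) id),
        hj.elim (fun h' => absurd h' h2) (fun h' => h'.elim (fun h'' => absurd h''.1 h1) id)⟩
    · rintro ⟨hi, hj⟩; exact ⟨Or.inr (Or.inr hi), Or.inr (Or.inr hj)⟩
  -- values under Q01 (e₁ closed, e₂ open), moved to Q00
  have v01_i : Q01.real Bi = u := by
    have step : Q01.real Bi = Q01.real U := by
      refine real_congr_on_sure s01 fun ω hω => ?_
      have h1 := nmem₁_zero 1 ω hω; have h2 := mem₂_one 0 ω hω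
      rw [chBi ω (rootfree 0 1 ω hω)]
      exact ⟨fun h => h.elim (fun h' => absurd h' h1) (fun h' => h'.2), fun h => Or.inr ⟨h2, h⟩⟩
    rw [step, cpl01, hu]; congr 1; ext ω; exact insU hs₂ ω
  have v01_j : Q01.real Bj = 1 := by
    rw [← probReal_univ (μ := Q01)]; refine real_congr_on_sure s01 fun ω hω => ?_
    simp only [Set.mem_univ, iff_true]; rw [chBj ω (rootfree 0 1 ω hω)]; exact Or.inl (mem₂_one 0 ω hω)
  have v01_ij : Q01.real (Bi ∩ Bj) = u := by
    have step : Q01.real (Bi ∩ Bj) = Q01.real U := by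
      refine real_congr_on_sure s01 fun ω hω => ?_
      have h1 := nmem₁_zero 1 ω hω; have h2 := mem₂_one 0 ω hω
      simp only [Set.mem_inter_iff]
      rw [chBi ω (rootfree 0 1 ω hω), chBj ω (rootfree 0 1 ω hω)]
      exact ⟨fun h => h.1.elim (fun h' => absurd h' h1) (fun h' => h'.2), fun h => ⟨Or.inr ⟨h2, h⟩, Or.inl h2⟩⟩
    rw [step, cpl01, hu]; congr 1; ext ω; exact insU hs₂ ω
  have f01_i : Q01.real ((fun ω : BondConfig (Fin n) => ω ∪ F) ⁻¹' Bi) = PIU := by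
    have step : Q01.real ((fun ω : BondConfig (Fin n) => ω ∪ F) ⁻¹' Bi) = Q01.real (I ∪ U) := by
      refine real_congr_on_sure s01 fun ω hω => ?_
      have h1 := nmem₁_zero 1 ω hω; have h2 := mem₂_one 0 ω hω
      simp only [Set.mem_preimage, Set.mem_union]; rw [chFBi ω (rootfree 0 1 ω hω)]
      constructor
      · rintro (h' | h' | h'); exacts [absurd h' h1, Or.inr h'.2, Or.inl h']
      · rintro (h | h); exacts [Or.inr (Or.inr h), Or.inr (Or.inl ⟨h2, h⟩)]
    rw [step, cpl01, hPIU]; congr 1; ext ω; simp only [Set.mem_preimage, Set.mem_union]; rw [insI hs₂ ω, insU hs₂ ω]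
  have f01_j : Q01.real ((fun ω : BondConfig (Fin n) => ω ∪ F) ⁻¹' Bj) = 1 := by
    rw [← probReal_univ (μ := Q01)]; refine real_congr_on_sure s01 fun ω hω => ?_
    simp only [Set.mem_preimage, Set.mem_univ, iff_true]; rw [chFBj ω (rootfree 0 1 ω hω)]; exact Or.inl (mem₂_one 0 ω hω)
  have f01_ij : Q01.real ((fun ω : BondConfig (Fin n) => ω ∪ F) ⁻¹' (Bi ∩ Bj)) = PIU := by
    have step : Q01.real ((fun ω : BondConfig (Fin n) => ω ∪ F) ⁻¹' (Bi ∩ Bj)) = Q01.real (I ∪ U) := by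
      refine real_congr_on_sure s01 fun ω hω => ?_
      have h1 := nmem₁_zero 1 ω hω; have h2 := mem₂_one 0 ω hω
      simp only [Set.mem_preimage, Set.mem_inter_iff, Set.mem_union]
      rw [chFBi ω (rootfree 0 1 ω hω), chFBj ω (rootfree 0 1 ω hω)]
      constructor
      · rintro ⟨(h' | h' | h'), -⟩; exacts [absurd h' h1, Or.inr h'.2, Or.inl h']
      · rintro (h | h); exacts [⟨Or.inr (Or.inr h), Or.inl h2⟩, ⟨Or.inr (Or.inl ⟨h2, h⟩), Or.inl h2⟩]
    rw [step, cpl01, hPIU]; congr 1; ext ω; simp only [Set.mem_preimage, Set.mem_union]; rw [insI hs₂ ω, insU hs₂ ω]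
  -- values under Q10 (e₁ open, e₂ closed), moved to Q00
  have v10_i : Q10.real Bi = 1 := by
    rw [← probReal_univ (μ := Q10)]; refine real_congr_on_sure s10 fun ω hω => ?_
    simp only [Set.mem_univ, iff_true]; rw [chBi ω (rootfree 1 0 ω hω)]; exact Or.inl (mem₁_one 0 ω hω)
  have v10_j : Q10.real Bj = u := by
    have step : Q10.real Bj = Q10.real U := by
      refine real_congr_on_sure s10 fun ω hω => ?_
      have h1 := mem₁_one 0 ω hω; have h2 := nmem₂_zero 1 ω hω
      rw [chBj ω (rootfree 1 0 ω hω)]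
      exact ⟨fun h => h.elim (fun h' => absurd h' h2) (fun h' => h'.2), fun h => Or.inr ⟨h1, h⟩⟩
    rw [step, cpl10, hu]; congr 1; ext ω; exact insU hs₁ ω
  have v10_ij : Q10.real (Bi ∩ Bj) = u := by
    have step : Q10.real (Bi ∩ Bj) = Q10.real U := by
      refine real_congr_on_sure s10 fun ω hω => ?_
      have h1 := mem₁_one 0 ω hω; have h2 := nmem₂_zero 1 ω hω
      simp only [Set.mem_inter_iff]
      rw [chBi ω (rootfree 1 0 ω hω), chBj ω (rootfree 1 0 ω hω)]
      exact ⟨fun h => h.2.elim (fun h' => absurd h' h2) (fun h' => h'.2), fun h => ⟨Or.inl h1, Or.inr ⟨h1, h⟩⟩⟩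
    rw [step, cpl10, hu]; congr 1; ext ω; exact insU hs₁ ω
  have f10_i : Q10.real ((fun ω : BondConfig (Fin n) => ω ∪ F) ⁻¹' Bi) = 1 := by
    rw [← probReal_univ (μ := Q10)]; refine real_congr_on_sure s10 fun ω hω => ?_
    simp only [Set.mem_preimage, Set.mem_univ, iff_true]; rw [chFBi ω (rootfree 1 0 ω hω)]; exact Or.inl (mem₁_one 0 ω hω)
  have f10_j : Q10.real ((fun ω : BondConfig (Fin n) => ω ∪ F) ⁻¹' Bj) = PJU := by
    have step : Q10.real ((fun ω : BondConfig (Fin n) => ω ∪ F) ⁻¹' Bj) = Q10.real (J ∪ U) := by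
      refine real_congr_on_sure s10 fun ω hω => ?_
      have h1 := mem₁_one 0 ω hω; have h2 := nmem₂_zero 1 ω hω
      simp only [Set.mem_preimage, Set.mem_union]; rw [chFBj ω (rootfree 1 0 ω hω)]
      constructor
      · rintro (h' | h' | h'); exacts [absurd h' h2, Or.inr h'.2, Or.inl h']
      · rintro (h | h); exacts [Or.inr (Or.inr h), Or.inr (Or.inl ⟨h1, h⟩)]
    rw [step, cpl10, hPJU]; congr 1; ext ω; simp only [Set.mem_preimage, Set.mem_union]; rw [insJ hs₁ ω, insU hs₁ ω]
  have f10_ij : Q10.real ((fun ω : BondConfig (Fin n) => ω ∪ F) ⁻¹' (Bi ∩ Bj)) = PJU := by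
    have step : Q10.real ((fun ω : BondConfig (Fin n) => ω ∪ F) ⁻¹' (Bi ∩ Bj)) = Q10.real (J ∪ U) := by
      refine real_congr_on_sure s10 fun ω hω => ?_
      have h1 := mem₁_one 0 ω hω; have h2 := nmem₂_zero 1 ω hω
      simp only [Set.mem_preimage, Set.mem_inter_iff, Set.mem_union]
      rw [chFBi ω (rootfree 1 0 ω hω), chFBj ω (rootfree 1 0 ω hω)]
      constructor
      · rintro ⟨-, (h' | h' | h')⟩; exacts [absurd h' h2, Or.inr h'.2, Or.inl h']
      · rintro (h | h); exacts [⟨Or.inl h1, Or.inr (Or.inr h)⟩, ⟨Or.inl h1, Or.inr (Or.inl ⟨h1, h⟩)⟩]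
    rw [step, cpl10, hPJU]; congr 1; ext ω; simp only [Set.mem_preimage, Set.mem_union]; rw [insJ hs₁ ω, insU hs₁ ω]
  -- values under Q11 (both gates open)
  have one11 : ∀ Z : Set (BondConfig (Fin n)), (∀ ω ∈ G11, ω ∈ Z) → Q11.real Z = 1 := by
    intro Z hZ; rw [← probReal_univ (μ := Q11)]
    refine real_congr_on_sure s11 fun ω hω => ?_; simp only [Set.mem_univ, iff_true]; exact hZ ω hω
  have B11 : ∀ ω ∈ G11, ω ∈ Bi ∧ ω ∈ Bj := by
    intro ω hω
    rw [chBi ω (rootfree 1 1 ω hω), chBj ω (rootfree 1 1 ω hω)]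
    exact ⟨Or.inl (mem₁_one 1 ω hω), Or.inl (mem₂_one 1 ω hω)⟩
  have FB11 : ∀ ω ∈ G11, (ω ∪ F : BondConfig (Fin n)) ∈ Bi ∧ (ω ∪ F : BondConfig (Fin n)) ∈ Bj := by
    intro ω hω
    rw [chFBi ω (rootfree 1 1 ω hω), chFBj ω (rootfree 1 1 ω hω)]
    exact ⟨Or.inl (mem₁_one 1 ω hω), Or.inl (mem₂_one 1 ω hω)⟩
  have v11_i : Q11.real Bi = 1 := one11 _ fun ω hω => (B11 ω hω).1
  have v11_j : Q11.real Bj = 1 := one11 _ fun ω hω => (B11 ω hω).2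
  have v11_ij : Q11.real (Bi ∩ Bj) = 1 := one11 _ fun ω hω => ⟨(B11 ω hω).1, (B11 ω hω).2⟩
  have f11_i : Q11.real ((fun ω : BondConfig (Fin n) => ω ∪ F) ⁻¹' Bi) = 1 := one11 _ fun ω hω => (FB11 ω hω).1
  have f11_j : Q11.real ((fun ω : BondConfig (Fin n) => ω ∪ F) ⁻¹' Bj) = 1 := one11 _ fun ω hω => (FB11 ω hω).2
  have f11_ij : Q11.real ((fun ω : BondConfig (Fin n) => ω ∪ F) ⁻¹' (Bi ∩ Bj)) = 1 :=
    one11 _ fun ω hω => ⟨(FB11 ω hω).1, (FB11 ω hω).2⟩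
  -- the six probabilities
  have eA1 : (prodBernoulli w1).real Bi = (1 - a) * (1 - b) * PI + (1 - a) * b * PIU + a * (1 - b) * 1 + a * b * 1 := by
    rw [real_twoBondDecomp w1 hne Bi, hw1e₁, hw1e₂, cplF 0 0, cplF 0 1, cplF 1 0, cplF 1 1, ← hQ00, ← hQ01, ← hQ10, ← hQ11,
      f00_i, f01_i, f10_i, f11_i]
  have eB1 : (prodBernoulli w1).real Bj = (1 - a) * (1 - b) * PJ + (1 - a) * b * 1 + a * (1 - b) * PJU + a * b * 1 := by
    rw [real_twoBondDecomp w1 hne Bj, hw1e₁, hw1e₂, cplF 0 0, cplF 0 1, cplF 1 0, cplF 1 1, ← hQ00, ← hQ01, ← hQ10, ← hQ11,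
      f00_j, f01_j, f10_j, f11_j]
  have eD1 : (prodBernoulli w1).real (Bi ∩ Bj) = (1 - a) * (1 - b) * PIJ + (1 - a) * b * PIU + a * (1 - b) * PJU + a * b * 1 := by
    rw [real_twoBondDecomp w1 hne (Bi ∩ Bj), hw1e₁, hw1e₂, cplF 0 0, cplF 0 1, cplF 1 0, cplF 1 1, ← hQ00, ← hQ01, ← hQ10, ← hQ11,
      f00_ij, f01_ij, f10_ij, f11_ij]
  have eA0 : (prodBernoulli w0).real Bi = (1 - a) * (1 - b) * 0 + (1 - a) * b * u + a * (1 - b) * 1 + a * b * 1 := by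
    rw [real_twoBondDecomp w0 hne Bi, ← ha, ← hb, ← hQ00, ← hQ01, ← hQ10, ← hQ11, v00_i, v01_i, v10_i, v11_i]
  have eB0 : (prodBernoulli w0).real Bj = (1 - a) * (1 - b) * 0 + (1 - a) * b * 1 + a * (1 - b) * u + a * b * 1 := by
    rw [real_twoBondDecomp w0 hne Bj, ← ha, ← hb, ← hQ00, ← hQ01, ← hQ10, ← hQ11, v00_j, v01_j, v10_j, v11_j]
  have eD0 : (prodBernoulli w0).real (Bi ∩ Bj) = (1 - a) * (1 - b) * 0 + (1 - a) * b * u + a * (1 - b) * u + a * b * 1 := by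
    rw [real_twoBondDecomp w0 hne (Bi ∩ Bj), ← ha, ← hb, ← hQ00, ← hQ01, ← hQ10, ← hQ11, v00_ij, v01_ij, v10_ij, v11_ij]
  -- the core
  have hIcore : (PI - PIJ + (PIJ - t) + t) * (u - t + (PJ - PIJ) + (PIJ - t) + t) ≤ PIJ - t + t := by
    have e1 : (PI - PIJ + (PIJ - t) + t) * (u - t + (PJ - PIJ) + (PIJ - t) + t) = PI * PJU := by
      rw [show u - t + (PJ - PIJ) + (PIJ - t) + t = PJU by linarith]; ring
    rw [e1, show PIJ - t + t = PIJ by ring]; exact hHarI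
  have hJcore : (PJ - PIJ + (PIJ - t) + t) * (u - t + (PI - PIJ) + (PIJ - t) + t) ≤ PIJ - t + t := by
    have e1 : (PJ - PIJ + (PIJ - t) + t) * (u - t + (PI - PIJ) + (PIJ - t) + t) = PJ * PIU := by
      rw [show u - t + (PI - PIJ) + (PIJ - t) + t = PIU by linarith]; ring
    rw [e1, show PIJ - t + t = PIJ by ring]; exact hHarJ
  have core := allOrNothing_core a b (u - t) (PI - PIJ) (PJ - PIJ) (PIJ - t) t
    ((prodBernoulli w1).real Bi) ((prodBernoulli w1).real Bj) ((prodBernoulli w1).real (Bi ∩ Bj))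
    ((prodBernoulli w0).real Bi) ((prodBernoulli w0).real Bj) ((prodBernoulli w0).real (Bi ∩ Bj))
    ha0 ha1 hb0 hb1 (by linarith) (by linarith) (by linarith) (by linarith) ht0 (by linarith) hIcore hJcore
    (by rw [eA1]; linear_combination (1 - a) * b * hIUe)
    (by rw [eB1]; linear_combination a * (1 - b) * hJUe)
    (by rw [eD1]; linear_combination (1 - a) * b * hIUe + a * (1 - b) * hJUe)
    (by rw [eA0]; ring) (by rw [eB0]; ring) (by rw [eD0]; ring)
  linarith [core]

end IncStar

end Summit.CriticalPhenomena.PercolationContinuityZ3.Theorems
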